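import Literature.Probability.LatticeModels.DartPhase
import Literature.Probability.LatticeModels.DirichletGreenFunction
import Literature.Probability.RandomPlanarGeometry.PlanarDomains
import Summits.CriticalPhenomena.CardyFormulaZ2.Theorems.CardySusyWardParafermionPrecompactKenyonDefs
import Summits.CriticalPhenomena.CardyFormulaZ2.Theorems.CardySusyWardParafermionPrecompactInnerCycleSteps
import Literature.Probability.LatticeModels.LatticeLoopEnclosure
import Literature.Probability.RandomPlanarGeometry.JordanDomainProofs

/-!
# Inner cycles of the turning rule do not wind around non-inner faces of a Jordan domain
# (helper for stub `stub_vertexRelation`)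

Line `kenyon-stream-second-relation` of the crux `ParafermionPrecompact` (route `CardySusyWard`,
item stmt-CriticalPhenomena-11293); continuation of `…InnerCycleSteps.lean`. This is where the
hypothesis `E.Ω = D.carrier` (the discrete Dobrushin datum lives in a JORDAN domain) of the
reshaped stub enters the proof of the vertex relation (DCS 2012, Prop. 8.6 at `q = 1`): the loops
excised/spliced by the one-edge involution must be oriented, and their orientation is read off a
winding number that has to vanish at the outer face of the start edge `e_a`.

Main result `codedCycle_W_eq_zero_of_not_isInnerFace` (registered helper): for a cycle of
`nextCorner β` all of whose corners have INNER faces, and a NON-inner face `o` with a corner in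
`Ω_δ`, the coded closed walk of the cycle (`c.v m = code (orb m)`, the tree's `RectLoop.code` and
`ClosedWalk` of `LatticeLoopWinding.lean`) has combinatorial winding number `W = 0` about the fine
face `2 o`. Proof: `W` is the winding number of the polygon of the walk about the centre of the
fine face (`ClosedWalk.wind_loop_sub_ctr`, `LatticeLoopEnclosure.lean`); rescaled by
`z ↦ δ(z + (1+i)/2)/2` the coded polygon becomes the polygon through the quarter-offset points
`δ(v + (u_k + u_{k+1})/4)` of the corners (Smirnov 2010, Fig. 5; `rescale_toC_code`), each of whose
steps lies in one of the open rectangles of `rect_subset_of_isInnerFace`, inside `Ω` and off the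
closed face `o` (`eq_faceAt_of_mem_closedSq`). The closed face `o` is convex, contains the image
of the centre and a point `y ∉ Ω` (`exists_mem_closedSq_not_mem`), and `ℂ ∖ Ω` is connected
(`JordanDomain.isPreconnected_compl`) and unbounded; winding numbers are constant on connected
sets off the curve (`wind_sub_eq_of_mem_connectedComponentIn`) and vanish far away
(`wind_eq_of_norm_sub_lt`).

References: S. Smirnov, Ann. of Math. 172 (2010), §4 [Smirnov2010]; H. Duminil-Copin,
S. Smirnov, Clay Math. Proc. 15 (2012), §8.3 [DuminilCopinSmirnov2012Lattice].
-/

noncomputable section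

namespace Summit.CriticalPhenomena.CardyFormulaZ2.Cruxes.ParafermionPrecompact.KenyonStreamSecondRelation

open Finset
open _root_.Literature.Topology.PlaneTopology _root_.Literature.Topology.PlaneTopology.RectLoop
open _root_.Literature.Probability.LatticeModels
open _root_.Literature.Probability.Percolation (BondConfig)
open _root_.Literature.Probability.RandomPlanarGeometry (DobrushinDomain)

section Jordan

open _root_.Literature.Topology.PlaneTopology.RectLoop (code codeOff dir)
open Complex Metric
open _root_.Literature.Topology.PlaneTopology (wind IsNonvanishingLoop)
open _root_.Literature.Probability (Percolation.coordVec Percolation.coordVec_zero Percolation.coordVec_one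
  Percolation.meshPoint_eq_smul)
open scoped Pointwise

variable {E : DiscreteDobrushin}

/-! ### The fine lattice, rescaled: codes go to quarter-offset points, fine faces to centres -/

/-- The rescaling `Φ(z) = δ (z + (1+i)/2) / 2` from the fine (code) lattice to the plane takes the
code of the corner `(v, k)` to the quarter-offset point `δ(v + (u_k + u_{k+1})/4)`, i.e. the point
`a = b = 1/4` of the rectangle parametrisation at `(v, k)`. [cite: Smirnov2010, §4 Fig. 5] -/
theorem rescale_toC_code (δ : ℝ) (v : Site 2) (k : Fin 4) :
    (δ : ℂ) * ((toC (code (v, k)) + (1 / 2 + 1 / 2 * I)) / 2) =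
      meshPoint δ v + (((1 / 4 : ℝ) : ℂ) + ((1 / 4 : ℝ) : ℂ) * I) * ((δ : ℂ) * I ^ (k : ℕ)) := by
  have hk : k = 0 ∨ k = 1 ∨ k = 2 ∨ k = 3 := by fin_cases k <;> simp
  rcases hk with rfl | rfl | rfl | rfl <;>
    apply Complex.ext <;> simp [toC, code, codeOff, meshPoint, Site.toComplex, pow_succ] <;> ring

/-- One FOLLOW step of the cycle, rescaled: the code of the successor goes to the point
`(a, b) = (1/4, 3/4)` of the rectangle at `(v, k)`. [cite: Smirnov2010, §4 Fig. 5] -/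
theorem rescale_toC_code_next_of_mem (δ : ℝ) {β : BondConfig (Site 2)} {p : Site 2 × Fin 4}
    (h : cTgt p ∈ β) :
    (δ : ℂ) * ((toC (code (nextCorner β p)) + (1 / 2 + 1 / 2 * I)) / 2) =
      meshPoint δ p.1 + (((1 / 4 : ℝ) : ℂ) + ((3 / 4 : ℝ) : ℂ) * I) * ((δ : ℂ) * I ^ (p.2 : ℕ)) := by
  have e : toC (code (nextCorner β p)) = toC (code p) + I ^ (p.2 : ℕ) * I := by
    rw [code_nextCorner_of_mem h, ← I_pow_fin_succ, ← embZ2_dir]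
    apply Complex.ext <;> simp [toC]
  rw [e, show (δ : ℂ) * ((toC (code p) + I ^ (p.2 : ℕ) * I + (1 / 2 + 1 / 2 * I)) / 2) =
    (δ : ℂ) * ((toC (code (p.1, p.2)) + (1 / 2 + 1 / 2 * I)) / 2) + (δ : ℂ) * I ^ (p.2 : ℕ) * I / 2 by
      rw [Prod.mk.eta]; ring, rescale_toC_code]
  push_cast; ring

/-- One CROSS step, rescaled: the successor goes to `(a, b) = (-1/4, 1/4)`. [cite: Smirnov2010, §4 Fig. 5] -/
theorem rescale_toC_code_next_of_not_mem (δ : ℝ) {β : BondConfig (Site 2)} {p : Site 2 × Fin 4}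
    (h : cTgt p ∉ β) :
    (δ : ℂ) * ((toC (code (nextCorner β p)) + (1 / 2 + 1 / 2 * I)) / 2) =
      meshPoint δ p.1 + (((-1 / 4 : ℝ) : ℂ) + ((1 / 4 : ℝ) : ℂ) * I) * ((δ : ℂ) * I ^ (p.2 : ℕ)) := by
  have e : toC (code (nextCorner β p)) = toC (code p) - I ^ (p.2 : ℕ) := by
    rw [code_nextCorner_of_not_mem h, sub_eq_add_neg, ← I_pow_fin_add_two, ← embZ2_dir]
    apply Complex.ext <;> simp [toC]
  rw [e, show (δ : ℂ) * ((toC (code p) - I ^ (p.2 : ℕ) + (1 / 2 + 1 / 2 * I)) / 2) =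
    (δ : ℂ) * ((toC (code (p.1, p.2)) + (1 / 2 + 1 / 2 * I)) / 2) - (δ : ℂ) * I ^ (p.2 : ℕ) / 2 by
      rw [Prod.mk.eta]; ring, rescale_toC_code]
  push_cast; ring

/-- The rescaling takes the centre of the fine face `2 o` to the centre of the face `o`.
[folklore] -/
theorem rescale_ctr (δ : ℝ) (o : Site 2) :
    (δ : ℂ) * ((ctr (2 * o 0, 2 * o 1) + (1 / 2 + 1 / 2 * I)) / 2) = δ • faceCenter o := by
  have hc : ctr (2 * o 0, 2 * o 1) = (2 * (o 0 : ℂ) + 1 / 2) + (2 * (o 1 : ℂ) + 1 / 2) * I := by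
    apply Complex.ext <;> simp [ctr]
  have hf : faceCenter o = ((o 0 : ℂ) + 1 / 2) + ((o 1 : ℂ) + 1 / 2) * I := by
    rw [faceCenter_eq]; apply Complex.ext <;> simp
  rw [hc, hf, Complex.real_smul]
  ring

/-- The rescaling is affine: it maps segments into segments. [folklore] -/
theorem rescale_mem_segment (δ : ℝ) {x y z : ℂ} (hz : z ∈ segment ℝ x y) :
    (δ : ℂ) * ((z + (1 / 2 + 1 / 2 * I)) / 2) ∈
      segment ℝ ((δ : ℂ) * ((x + (1 / 2 + 1 / 2 * I)) / 2)) ((δ : ℂ) * ((y + (1 / 2 + 1 / 2 * I)) / 2)) := by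
  obtain ⟨a, b, ha, hb, hab, rfl⟩ := hz
  refine ⟨a, b, ha, hb, hab, ?_⟩
  have hb' : (b : ℂ) = 1 - a := by rw [eq_sub_iff_add_eq, add_comm]; exact_mod_cast hab
  simp only [Complex.real_smul, hb']
  ring

/-- The rectangle parametrisation is affine: a point of the segment between two of its points is
one of its points, with parameters on the corresponding parameter segment. [folklore] -/
theorem exists_params_of_mem_segment {P U : ℂ} {a₀ b₀ a₁ b₁ : ℝ} {z : ℂ}
    (hz : z ∈ segment ℝ (P + ((a₀ : ℂ) + (b₀ : ℂ) * I) * U) (P + ((a₁ : ℂ) + (b₁ : ℂ) * I) * U)) :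
    ∃ s t : ℝ, 0 ≤ s ∧ 0 ≤ t ∧ s + t = 1 ∧
      z = P + (((s * a₀ + t * a₁ : ℝ) : ℂ) + ((s * b₀ + t * b₁ : ℝ) : ℂ) * I) * U := by
  obtain ⟨s, t, hs, ht, hst, rfl⟩ := hz
  refine ⟨s, t, hs, ht, hst, ?_⟩
  have ht' : (t : ℂ) = 1 - s := by rw [eq_sub_iff_add_eq, add_comm]; exact_mod_cast hst
  simp only [Complex.real_smul]
  push_cast
  rw [ht']
  ring

/-! ### The winding number of the rescaled coded polygon about a non-inner face vanishes -/

/-- **Inner cycles do not wind around non-inner faces** (registered helper of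
`stub_vertexRelation`). Let the domain of the discrete Dobrushin datum `E` be (the carrier of) a
Jordan domain, let a cycle of the turning rule consist of corners with INNER faces, and let `o` be
a NON-inner face one of whose corners lies in `Ω_δ` (e.g. the outer face of the `A`–`B` edge
`e_a`). Then the coded closed walk of the cycle has winding number `0` about the fine face `2 o`.
Proof: that winding number is the winding number of the rescaled coded polygon about the centre
of `o` (`wind_loop_sub_ctr`); the rescaled polygon runs through the open faces of the cycle and
the interiors of the unions of consecutive faces across crossed edges, all inside `Ω`
(`rect_subset_of_isInnerFace`) and off the closed face `o` (`eq_faceAt_of_mem_closedSq`); the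
closed face `o` is convex and contains a point `y ∉ Ω` (`exists_mem_closedSq_not_mem`), and
`ℂ ∖ Ω` is connected (`JordanDomain.isPreconnected_compl`) and unbounded, so the winding number
about the centre of `o` equals that about `y`, equals that about a far point, equals `0`.
[cite: DuminilCopinSmirnov2012Lattice, §8.3 (Prop. 8.6: Dobrushin domains are simply connected)] -/
theorem codedCycle_W_eq_zero_of_not_isInnerFace :
    ∀ (D : DobrushinDomain) (E : DiscreteDobrushin), E.Ω = D.carrier → 0 < E.δ →
      ∀ (β : BondConfig (Site 2)) (q : Site 2 × Fin 4) (Q : ℕ), 0 < Q → cornerOrbit β q Q = q →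
        (∀ m, E.IsInnerFace (cFace (cornerOrbit β q m))) →
          ∀ (o w : Site 2), ¬ E.IsInnerFace o → IsCorner w o → w ∈ meshDomain E.Ω E.δ →
            ∀ c : ClosedWalk Q, (∀ m, c.v m = RectLoop.code (cornerOrbit β q m)) →
              c.W (2 * o 0, 2 * o 1) = 0 := by
  intro D E hΩ hδ β q Q hQ0 hQ hinner o w ho hw hwD c hc
  -- the rescaling and the rescaled polygon
  set Φ : ℂ → ℂ := fun z => (E.δ : ℂ) * ((z + (1 / 2 + 1 / 2 * I)) / 2) with hΦ
  have hΦsub : ∀ x y, Φ x - Φ y = (E.δ / 2 : ℂ) * (x - y) := by intro x y; simp only [hΦ]; ring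
  set F : ℤ × ℤ := (2 * o 0, 2 * o 1) with hF
  set Γ : ℝ → ℂ := fun t => Φ (c.loop.extend t) with hΓ
  have hΓc : Continuous Γ := by
    simp only [hΓ, hΦ]
    exact continuous_const.mul ((c.loop.continuous_extend.add continuous_const).div_const _)
  have hΓ01 : Γ 0 = Γ 1 := by simp only [hΓ, Path.extend_zero, Path.extend_one]
  -- (1) every point of the rescaled polygon lies in `Ω` and off the closed face `o`
  have key : ∀ t, Γ t ∈ E.Ω ∧ Γ t ∉ E.δ • closedSq o := by
    intro t
    have hmem : c.loop.extend t ∈ Set.range c.loop := by rw [← Path.extend_range]; exact ⟨t, rfl⟩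
    have := c.range_loop_subset hQ0 hmem
    simp only [Set.mem_iUnion, Finset.mem_range, exists_prop] at this
    obtain ⟨j, -, hj⟩ := this
    have hz := rescale_mem_segment E.δ hj
    rw [hc j, hc (j + 1)] at hz
    change Γ t ∈ segment ℝ _ _ at hz
    set p := cornerOrbit β q j with hp
    have hsucc : cornerOrbit β q (j + 1) = nextCorner β p := rfl
    rw [hsucc, show p = (p.1, p.2) from rfl, rescale_toC_code] at hz
    simp only [Prod.mk.eta] at hz
    have hfin : E.IsInnerFace (faceAt p.1 p.2) := hinner j
    by_cases hmb : cTgt p ∈ β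
    · -- follow step: inside the open face `faceAt v k`
      rw [rescale_toC_code_next_of_mem _ hmb] at hz
      obtain ⟨s, u, hs, hu, hsu, hzeq⟩ := exists_params_of_mem_segment hz
      have ha : s * (1 / 4) + u * (1 / 4) = 1 / 4 := by nlinarith
      rw [ha] at hzeq
      constructor
      · rw [hzeq]
        exact rect_subset_of_isInnerFace D E hΩ hδ p.1 p.2 0 (Or.inl rfl) hfin (fun h => by norm_num at h) _ _
          (by norm_num) (by norm_num) (by nlinarith) (by nlinarith)
      · rw [hzeq]
        intro hbad
        rcases eq_faceAt_of_mem_closedSq hδ (by norm_num) (by norm_num) (by nlinarith) (by nlinarith) hbad with h | ⟨-, h⟩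
        · exact ho (h ▸ hfin)
        · norm_num at h
    · -- cross step: inside the interior of `faceAt v k ∪ faceAt v (k+1)`
      rw [rescale_toC_code_next_of_not_mem _ hmb] at hz
      obtain ⟨s, u, hs, hu, hsu, hzeq⟩ := exists_params_of_mem_segment hz
      have hb : s * (1 / 4) + u * (1 / 4) = 1 / 4 := by nlinarith
      rw [hb] at hzeq
      have hfin' : E.IsInnerFace (faceAt p.1 (p.2 + 1)) := by
        have := hinner (j + 1)
        rwa [hsucc, cFace_nextCorner_of_not_mem hmb] at this
      constructor
      · rw [hzeq]
        exact rect_subset_of_isInnerFace D E hΩ hδ p.1 p.2 (-1) (Or.inr rfl) hfin (fun _ => hfin') _ _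
          (by nlinarith) (by nlinarith) (by norm_num) (by norm_num)
      · rw [hzeq]
        intro hbad
        rcases eq_faceAt_of_mem_closedSq hδ (by nlinarith) (by nlinarith) (by norm_num) (by norm_num) hbad with h | ⟨h, -⟩
        · exact ho (h ▸ hfin)
        · exact ho (h ▸ hfin')
  -- (2) the winding number of the fine face is that of the rescaled polygon about the centre of `o`
  have hctr : ctr F ∉ Set.range c.loop := c.ctr_notMem_range_loop F
  have hg : IsNonvanishingLoop fun t => c.loop.extend t - ctr F := by
    refine ⟨(c.loop.continuous_extend.sub continuous_const).continuousOn, fun t _ h => hctr ?_, ?_⟩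
    · rw [sub_eq_zero] at h
      rw [← h, ← Path.extend_range]; exact ⟨t, rfl⟩
    · simp only [Path.extend_zero, Path.extend_one]
  have hW : (c.W F : ℤ) = wind fun t => Γ t - Φ (ctr F) := by
    rw [← c.wind_loop_sub_ctr hQ0 F]
    have e : (fun t => Γ t - Φ (ctr F)) = fun t => (fun _ : ℝ => (E.δ / 2 : ℂ)) t * (c.loop.extend t - ctr F) := by
      funext t; exact hΦsub _ _
    rw [e, _root_.Literature.Topology.PlaneTopology.wind_mul (IsNonvanishingLoop.const ?_) hg,
      _root_.Literature.Topology.PlaneTopology.wind_const, zero_add]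
    exact div_ne_zero (Complex.ofReal_ne_zero.2 hδ.ne') two_ne_zero
  rw [hW]
  -- (3) move the base point inside the closed face `o` to a point off `Ω`
  obtain ⟨y, hy, hyΩ⟩ := exists_mem_closedSq_not_mem ho hw hwD
  set K : Set ℂ := Set.range Γ with hK
  have hKc : IsCompact K := by
    rw [hK, show Γ = Φ ∘ c.loop.extend from rfl, Set.range_comp, Path.extend_range]
    exact (isCompact_range c.loop.continuous).image (by
      simp only [hΦ]; exact continuous_const.mul ((continuous_id.add continuous_const).div_const _))
  have hKΩ : K ⊆ E.Ω := by rintro z ⟨t, rfl⟩; exact (key t).1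
  have hKsq : Disjoint K (E.δ • closedSq o) := by
    rw [Set.disjoint_left]; rintro z ⟨t, rfl⟩; exact (key t).2
  have hmaps : Set.MapsTo Γ (Set.Icc 0 1) K := fun t _ => ⟨t, rfl⟩
  have hconv : Convex ℝ (E.δ • closedSq o) := (convex_closedSq o).smul E.δ
  have hctr' : Φ (ctr F) ∈ E.δ • closedSq o := by
    simp only [hΦ, hF]
    rw [rescale_ctr]
    refine Set.smul_mem_smul_set fun i => ?_
    rw [coordVec_faceCenter]
    constructor <;> linarith
  have h3 : wind (fun t => Γ t - Φ (ctr F)) = wind (fun t => Γ t - y) :=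
    _root_.Literature.Topology.PlaneTopology.wind_sub_eq_of_mem_connectedComponentIn hΓc.continuousOn hΓ01
      hKc.isClosed hmaps (hconv.isPreconnected.subset_connectedComponentIn hctr'
        (fun z hz => Set.disjoint_right.1 hKsq hz) hy)
  rw [h3]
  -- (4) move it far away inside the connected unbounded complement of `Ω`
  obtain ⟨R₁, hR₁⟩ := (Metric.isBounded_iff_subset_closedBall (0 : ℂ)).1 D.isBounded
  obtain ⟨R₂, hR₂⟩ := (Metric.isBounded_iff_subset_closedBall (0 : ℂ)).1 hKc.isBounded
  set yf : ℂ := ((|R₁| + |R₂| + 1 : ℝ) : ℂ) with hyf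
  have hyf_norm : ‖yf‖ = |R₁| + |R₂| + 1 := by
    rw [hyf, Complex.norm_real, Real.norm_eq_abs, abs_of_pos (by positivity)]
  have hyfΩ : yf ∉ E.Ω := by
    intro h
    rw [hΩ] at h
    have := hR₁ h
    rw [Metric.mem_closedBall, dist_zero_right, hyf_norm] at this
    linarith [le_abs_self R₁, abs_nonneg R₂]
  have hcompl : E.Ωᶜ ⊆ Kᶜ := Set.compl_subset_compl.2 hKΩ
  have hpre : IsPreconnected E.Ωᶜ := by rw [hΩ]; exact D.toJordanDomain.isPreconnected_compl
  have h4 : wind (fun t => Γ t - y) = wind (fun t => Γ t - yf) :=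
    _root_.Literature.Topology.PlaneTopology.wind_sub_eq_of_mem_connectedComponentIn hΓc.continuousOn hΓ01
      hKc.isClosed hmaps (hpre.subset_connectedComponentIn hyΩ hcompl hyfΩ)
  rw [h4]
  -- (5) far away the winding number vanishes (Rouché against the constant loop)
  have h5 : wind (fun t => Γ t - yf) = wind (fun _ : ℝ => -yf) := by
    refine _root_.Literature.Topology.PlaneTopology.wind_eq_of_norm_sub_lt
      (hΓc.sub continuous_const).continuousOn (by rw [hΓ01])
      (IsNonvanishingLoop.const (neg_ne_zero.2 ?_)) fun t _ => ?_
    · rw [← norm_pos_iff, hyf_norm]; positivity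
    · rw [show Γ t - yf - -yf = Γ t by ring, norm_neg, hyf_norm]
      have := hR₂ ⟨t, rfl⟩
      rw [Metric.mem_closedBall, dist_zero_right] at this
      linarith [le_abs_self R₂, abs_nonneg R₁]
  rw [h5, _root_.Literature.Topology.PlaneTopology.wind_const]

end Jordan

end Summit.CriticalPhenomena.CardyFormulaZ2.Cruxes.ParafermionPrecompact.KenyonStreamSecondRelation

end
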